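import Summits.BirchSwinnertonDyer.BirchSwinnertonDyer.Theorems.Rank2Observatory2DescClFamCert
import Summits.BirchSwinnertonDyer.BirchSwinnertonDyer.Theorems.Rank2Observatory2DescClFieldCertQ2Sound
import HarnessLib

/-!
# BirchSwinnertonDyer — rank ≥ 2 observatory: KERNEL-2DESC-CL Q2 — family entries over a two-prime field record (`famCheck₂`), part 2

HONEST FRAMING: per-curve certified theorems and census instruments; no claim on BSD in rank ≥ 2.

Part 2 of the two-auxiliary-prime variant (part 1: `Rank2Observatory2DescClFieldCertQ2`).  For a checked
`fc : ClFieldCertQ2` realised in `K = ℚ(α)` this file provides the four height-one primes `W₁₁, W₁₂` (above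
`q₁`) and `W₂₁, W₂₂` (above `q₂`) as terms, the row lookup `fc.row p`, and the **family-entry check**
`famCheck₂ fc D f` of the `T`-unit family of a curve, `T = supp(D) ∪ {W₁₁, W₁₂, W₂₁, W₂₂}`, `M = D·q₁q₂`:
`FamEntry = kind × code × ElemEntry` (the landed element type, reused) with `kind = 0` unit, `1` the element
`q₁`, `4` the element `q₂`, `2` registry element `g_P` with `(g_P) = P · W₁₁^{e₁} · W₂₁^{e₂}` (own code `P`),
`3` an element `γ` with `(γ) = W₁₁^{e₁} W₂₁^{e₂}` (the field record carries two, `γ₁, γ₂`, a basis of the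
relation lattice of `[W₁₁], [W₂₁]`).  The exponent pair is packed in `ElemEntry.e` as `e₁ + 64·e₂`; the inverse
certificates at `W₁₂`, `W₂₂` and at the other primes above `p` are looked up in `ElemEntry.invs` (existential,
position-free), so no new data type is needed.  Soundness lemmas, exactly as part 4 of v2.0: `g ≠ 0`, support
`⊆ supp(D·q₁q₂)` (`supp_of_famCheck₂`), the four integers `log ord_{W}(g)` (`log_W₁₁/W₁₂/W₂₁/W₂₂_of_famCheck₂`),
the sign bit, the norm, the residue-character non-divisibility.

Sorry-free; new declarations only; axioms `propext`, `Classical.choice`, `Quot.sound`.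
[cite: Cohen1993, §4.8.2, §6.5] [cite: Marcus2018, Ch. 3, Thm. 22; Ch. 5, Thm. 38] [cite: Cassels1991LecturesEllipticCurves, §15]
-/

set_option linter.dupNamespace false

noncomputable section

open scoped Classical NumberField nonZeroDivisors

open Literature.NumberTheory.NumberFields Polynomial Module NumberField IsDedekindDomain Ideal

namespace Summit.BirchSwinnertonDyer.BirchSwinnertonDyer.Rank2Observatory.TwoDescCl

open TwoDescCubic

/-! ## Computable data -/

namespace ClFieldCertQ2

variable (fc : ClFieldCertQ2)

/-- The registry row of the rational prime `p` (a junk inert row if absent; `famCheck₂` certifies presence). -/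
def row (p : ℕ) : PrimeEntry := (fc.primes.find? fun e => e.p == p).getD ⟨p, 2, (0, 0, 0), (0, 0, 0), [], []⟩

end ClFieldCertQ2

/-- Some triple of the list is an inverse certificate of `g` at the code `C` (`g ∉ (p, G(α))`). Computable. -/
def invAny (a b c : ℤ) (C : PCode) (g : ℤ × ℤ × ℤ) (ys : List (ℤ × ℤ × ℤ)) : Bool :=
  ys.any fun y => invCert a b c C g y

/-- The kind-specific part of the two-prime entry check (`0` unit, `1` = `q₁`, `4` = `q₂`, `2` registry element,
`3` = `γ`). Computable. [cite: Cohen1993, §6.5] -/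
def famKindCheck₂ (fc : ClFieldCertQ2) (D : ℤ × ℤ × ℤ) (f : FamEntry) : Bool :=
  if f.1 = 0 then unitCert fc.a fc.b fc.c f.2.2.g f.2.2.δ
  else if f.1 = 1 then decide (f.2.2.g = ((fc.q₁ : ℤ), 0, 0))
  else if f.1 = 4 then decide (f.2.2.g = ((fc.q₂ : ℤ), 0, 0))
  else if f.1 = 2 then
    (fc.primes.any fun e => e.p == f.2.1.1) && decide (f.2.1 ∈ (fc.row f.2.1.1).codes) &&
      memCode f.2.1 D && prodPowCert fc.a fc.b fc.c f.2.2.g f.2.2.δ (f.2.1.1 * (fc.q₁ * fc.q₂)) f.2.2.k &&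
      invAny fc.a fc.b fc.c fc.w₁₂ f.2.2.g f.2.2.invs && invAny fc.a fc.b fc.c fc.w₂₂ f.2.2.g f.2.2.invs &&
      ordCheck fc.q₁ (normFormZ fc.a fc.b fc.c f.2.2.g.1 f.2.2.g.2.1 f.2.2.g.2.2).natAbs (f.2.2.e % 64) &&
      ordCheck fc.q₂ (normFormZ fc.a fc.b fc.c f.2.2.g.1 f.2.2.g.2.1 f.2.2.g.2.2).natAbs (f.2.2.e / 64) &&
      ((fc.row f.2.1.1).codes.all fun C' => C' == f.2.1 || invAny fc.a fc.b fc.c C' f.2.2.g f.2.2.invs)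
  else if f.1 = 3 then
    prodPowCert fc.a fc.b fc.c f.2.2.g f.2.2.δ (1 * (fc.q₁ * fc.q₂)) f.2.2.k &&
      invAny fc.a fc.b fc.c fc.w₁₂ f.2.2.g f.2.2.invs && invAny fc.a fc.b fc.c fc.w₂₂ f.2.2.g f.2.2.invs &&
      ordCheck fc.q₁ (normFormZ fc.a fc.b fc.c f.2.2.g.1 f.2.2.g.2.1 f.2.2.g.2.2).natAbs (f.2.2.e % 64) &&
      ordCheck fc.q₂ (normFormZ fc.a fc.b fc.c f.2.2.g.1 f.2.2.g.2.1 f.2.2.g.2.2).natAbs (f.2.2.e / 64)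
  else false

/-- **The two-prime family-entry check**: sign test, non-zero norm, residue-character non-divisibility, and the
kind-specific certificates. Computable. [cite: Cassels1991LecturesEllipticCurves, §15] -/
def famCheck₂ (fc : ClFieldCertQ2) (D : ℤ × ℤ × ℤ) (f : FamEntry) : Bool :=
  signCond fc.lo fc.hi f.2.2.g f.2.2.sg &&
    decide (normFormZ fc.a fc.b fc.c f.2.2.g.1 f.2.2.g.2.1 f.2.2.g.2.2 ≠ 0) &&
    (fc.chars.all fun ch => !decide ((ch.1 : ℤ) ∣ evalInt ch.2.1 f.2.2.g)) && famKindCheck₂ fc D f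

/-- `log ord_{W₁₁}` of an entry. -/
def famL₁₁ (f : FamEntry) : ℤ :=
  if f.1 = 0 then 0 else if f.1 = 1 then -1 else if f.1 = 4 then 0 else -((f.2.2.e % 64 : ℕ) : ℤ)

/-- `log ord_{W₁₂}` of an entry. -/
def famL₁₂ (f : FamEntry) : ℤ := if f.1 = 1 then -1 else 0

/-- `log ord_{W₂₁}` of an entry. -/
def famL₂₁ (f : FamEntry) : ℤ :=
  if f.1 = 0 then 0 else if f.1 = 1 then 0 else if f.1 = 4 then -1 else -((f.2.2.e / 64 : ℕ) : ℤ)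

/-- `log ord_{W₂₂}` of an entry. -/
def famL₂₂ (f : FamEntry) : ℤ := if f.1 = 4 then -1 else 0

/-! ## Soundness -/

variable {K : Type*} [Field K] [NumberField K] {θ : K} (fc : ClFieldCertQ2)

section InvAny

variable {a b c : ℤ}

/-- `g ∉ w` from some inverse certificate of the list. [folklore] -/
theorem lin_not_mem_of_invAny (hθ : aeval θ (MonicCubic.poly a b c) = 0) {P : PCode}
    (w : HeightOneSpectrum (𝓞 K)) (hw : w.asIdeal = idealOf hθ P) {x : ℤ × ℤ × ℤ} {ys : List (ℤ × ℤ × ℤ)}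
    (h : invAny a b c P x ys = true) : lin hθ x.1 x.2.1 x.2.2 ∉ w.asIdeal := by
  obtain ⟨y, -, hy⟩ := List.any_eq_true.mp h
  exact lin_not_mem_of_invCert hθ w hw hy

/-- `v_w(g) = 1` from some inverse certificate of the list. [folklore] -/
theorem valuation_eq_one_of_invAny (hθ : aeval θ (MonicCubic.poly a b c) = 0) {P : PCode}
    (w : HeightOneSpectrum (𝓞 K)) (hw : w.asIdeal = idealOf hθ P) {x : ℤ × ℤ × ℤ} {ys : List (ℤ × ℤ × ℤ)}
    (h : invAny a b c P x ys = true) : w.valuation K ((lin hθ x.1 x.2.1 x.2.2 : 𝓞 K) : K) = 1 :=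
  valuation_eq_one_of_not_mem w (lin_not_mem_of_invAny hθ w hw h)

end InvAny

namespace ClFieldCertQ2

/-- The code of `W₁₁` is a code of the row of `q₁`. -/
theorem w₁₁_mem_codes : fc.w₁₁ ∈ fc.qEntry₁.codes := by rw [qEntry₁_codes]; simp

/-- The code of `W₁₂` is a code of the row of `q₁`. -/
theorem w₁₂_mem_codes : fc.w₁₂ ∈ fc.qEntry₁.codes := by rw [qEntry₁_codes]; simp

/-- The code of `W₂₁` is a code of the row of `q₂`. -/
theorem w₂₁_mem_codes : fc.w₂₁ ∈ fc.qEntry₂.codes := by rw [qEntry₂_codes]; simp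

/-- The code of `W₂₂` is a code of the row of `q₂`. -/
theorem w₂₂_mem_codes : fc.w₂₂ ∈ fc.qEntry₂.codes := by rw [qEntry₂_codes]; simp

/-- **`W₁₁`** as a height-one prime. -/
def W₁₁ (hθ : aeval θ (MonicCubic.poly fc.a fc.b fc.c) = 0) (h3 : finrank ℚ K = 3) (hF : fc.check = true)
    (hpr : fc.primeList.Forall Nat.Prime) : HeightOneSpectrum (𝓞 K) :=
  primeOfCode (fc.irreducible_of_check hF) hθ h3 (e := fc.qEntry₁) (fc.q₁_prime hpr) (fc.qEntry₁_check hF)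
    fc.w₁₁_mem_codes

/-- **`W₁₂`** as a height-one prime. -/
def W₁₂ (hθ : aeval θ (MonicCubic.poly fc.a fc.b fc.c) = 0) (h3 : finrank ℚ K = 3) (hF : fc.check = true)
    (hpr : fc.primeList.Forall Nat.Prime) : HeightOneSpectrum (𝓞 K) :=
  primeOfCode (fc.irreducible_of_check hF) hθ h3 (e := fc.qEntry₁) (fc.q₁_prime hpr) (fc.qEntry₁_check hF)
    fc.w₁₂_mem_codes

/-- **`W₂₁`** as a height-one prime. -/
def W₂₁ (hθ : aeval θ (MonicCubic.poly fc.a fc.b fc.c) = 0) (h3 : finrank ℚ K = 3) (hF : fc.check = true)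
    (hpr : fc.primeList.Forall Nat.Prime) : HeightOneSpectrum (𝓞 K) :=
  primeOfCode (fc.irreducible_of_check hF) hθ h3 (e := fc.qEntry₂) (fc.q₂_prime hpr) (fc.qEntry₂_check hF)
    fc.w₂₁_mem_codes

/-- **`W₂₂`** as a height-one prime. -/
def W₂₂ (hθ : aeval θ (MonicCubic.poly fc.a fc.b fc.c) = 0) (h3 : finrank ℚ K = 3) (hF : fc.check = true)
    (hpr : fc.primeList.Forall Nat.Prime) : HeightOneSpectrum (𝓞 K) :=
  primeOfCode (fc.irreducible_of_check hF) hθ h3 (e := fc.qEntry₂) (fc.q₂_prime hpr) (fc.qEntry₂_check hF)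
    fc.w₂₂_mem_codes

variable {fc}

section W
variable (hθ : aeval θ (MonicCubic.poly fc.a fc.b fc.c) = 0) (h3 : finrank ℚ K = 3) (hF : fc.check = true)
  (hpr : fc.primeList.Forall Nat.Prime)

/-- `W₁₁` is presented by its code. -/
theorem W₁₁_asIdeal : (fc.W₁₁ hθ h3 hF hpr).asIdeal = idealOf hθ fc.w₁₁ := rfl

/-- `W₁₂` is presented by its code. -/
theorem W₁₂_asIdeal : (fc.W₁₂ hθ h3 hF hpr).asIdeal = idealOf hθ fc.w₁₂ := rfl

/-- `W₂₁` is presented by its code. -/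
theorem W₂₁_asIdeal : (fc.W₂₁ hθ h3 hF hpr).asIdeal = idealOf hθ fc.w₂₁ := rfl

/-- `W₂₂` is presented by its code. -/
theorem W₂₂_asIdeal : (fc.W₂₂ hθ h3 hF hpr).asIdeal = idealOf hθ fc.w₂₂ := rfl

/-- `W₁₁ ≠ W₁₂`. -/
theorem W₁₁_ne_W₁₂ : fc.W₁₁ hθ h3 hF hpr ≠ fc.W₁₂ hθ h3 hF hpr := fun h =>
  fc.w₁₁_ne_w₁₂ hθ h3 hF hpr (congrArg HeightOneSpectrum.asIdeal h)

/-- `W₂₁ ≠ W₂₂`. -/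
theorem W₂₁_ne_W₂₂ : fc.W₂₁ hθ h3 hF hpr ≠ fc.W₂₂ hθ h3 hF hpr := fun h =>
  fc.w₂₁_ne_w₂₂ hθ h3 hF hpr (congrArg HeightOneSpectrum.asIdeal h)

/-- `N(W₁₁) = q₁`. -/
theorem absNorm_W₁₁ : absNorm (fc.W₁₁ hθ h3 hF hpr).asIdeal = fc.q₁ := (fc.w₁₁_of_check hθ h3 hF hpr).2

/-- `N(W₁₂) = q₁²`. -/
theorem absNorm_W₁₂ : absNorm (fc.W₁₂ hθ h3 hF hpr).asIdeal = fc.q₁ ^ 2 := (fc.w₁₂_of_check hθ h3 hF hpr).2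

/-- `N(W₂₁) = q₂`. -/
theorem absNorm_W₂₁ : absNorm (fc.W₂₁ hθ h3 hF hpr).asIdeal = fc.q₂ := (fc.w₂₁_of_check hθ h3 hF hpr).2

/-- `N(W₂₂) = q₂²`. -/
theorem absNorm_W₂₂ : absNorm (fc.W₂₂ hθ h3 hF hpr).asIdeal = fc.q₂ ^ 2 := (fc.w₂₂_of_check hθ h3 hF hpr).2

/-- `q₁ ∈ W₁₁`. -/
theorem q₁_mem_W₁₁ : ((fc.q₁ : ℕ) : 𝓞 K) ∈ (fc.W₁₁ hθ h3 hF hpr).asIdeal :=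
  natCast_mem_idealOf hθ (e := fc.qEntry₁) fc.w₁₁_mem_codes

/-- `q₁ ∈ W₁₂`. -/
theorem q₁_mem_W₁₂ : ((fc.q₁ : ℕ) : 𝓞 K) ∈ (fc.W₁₂ hθ h3 hF hpr).asIdeal :=
  natCast_mem_idealOf hθ (e := fc.qEntry₁) fc.w₁₂_mem_codes

/-- `q₂ ∈ W₂₁`. -/
theorem q₂_mem_W₂₁ : ((fc.q₂ : ℕ) : 𝓞 K) ∈ (fc.W₂₁ hθ h3 hF hpr).asIdeal :=
  natCast_mem_idealOf hθ (e := fc.qEntry₂) fc.w₂₁_mem_codes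

/-- `q₂ ∈ W₂₂`. -/
theorem q₂_mem_W₂₂ : ((fc.q₂ : ℕ) : 𝓞 K) ∈ (fc.W₂₂ hθ h3 hF hpr).asIdeal :=
  natCast_mem_idealOf hθ (e := fc.qEntry₂) fc.w₂₂_mem_codes

/-- Every height-one prime containing `q₁` is `W₁₁` or `W₁₂`. [cite: Cohen1993, §4.8.2, Thm. 4.8.13] -/
theorem eq_W₁₁_or_W₁₂ (u : HeightOneSpectrum (𝓞 K)) (hu : ((fc.q₁ : ℕ) : 𝓞 K) ∈ u.asIdeal) :
    u = fc.W₁₁ hθ h3 hF hpr ∨ u = fc.W₁₂ hθ h3 hF hpr := by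
  rcases fc.qcover₁_of_check hθ h3 hF hpr u.asIdeal u.isPrime hu with h | h
  · exact Or.inl (HeightOneSpectrum.ext h)
  · exact Or.inr (HeightOneSpectrum.ext h)

/-- Every height-one prime containing `q₂` is `W₂₁` or `W₂₂`. [cite: Cohen1993, §4.8.2, Thm. 4.8.13] -/
theorem eq_W₂₁_or_W₂₂ (u : HeightOneSpectrum (𝓞 K)) (hu : ((fc.q₂ : ℕ) : 𝓞 K) ∈ u.asIdeal) :
    u = fc.W₂₁ hθ h3 hF hpr ∨ u = fc.W₂₂ hθ h3 hF hpr := by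
  rcases fc.qcover₂_of_check hθ h3 hF hpr u.asIdeal u.isPrime hu with h | h
  · exact Or.inl (HeightOneSpectrum.ext h)
  · exact Or.inr (HeightOneSpectrum.ext h)

end W

omit [NumberField K] in
/-- `q₂ ∉ u` for a prime `u ∋ q₁` (in particular `W₁₁`, `W₁₂`). -/
theorem q₂_not_mem_of_q₁_mem (hF : fc.check = true) (hpr : fc.primeList.Forall Nat.Prime)
    (u : HeightOneSpectrum (𝓞 K)) (hu : ((fc.q₁ : ℕ) : 𝓞 K) ∈ u.asIdeal) : ((fc.q₂ : ℕ) : 𝓞 K) ∉ u.asIdeal :=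
  fc.not_mem_of_mem_q₁ hF hpr u.isPrime hu

omit [NumberField K] in
/-- `q₁ ∉ u` for a prime `u ∋ q₂` (in particular `W₂₁`, `W₂₂`). -/
theorem q₁_not_mem_of_q₂_mem (hF : fc.check = true) (hpr : fc.primeList.Forall Nat.Prime)
    (u : HeightOneSpectrum (𝓞 K)) (hu : ((fc.q₂ : ℕ) : 𝓞 K) ∈ u.asIdeal) : ((fc.q₁ : ℕ) : 𝓞 K) ∉ u.asIdeal :=
  fun h₁ => fc.not_mem_of_mem_q₁ hF hpr u.isPrime h₁ hu


/-- A present registry row: `fc.row p ∈ fc.primes` with `(fc.row p).p = p`. [folklore] -/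
theorem row_mem {fc : ClFieldCertQ2} {p : ℕ} (h : (fc.primes.any fun e => e.p == p) = true) :
    fc.row p ∈ fc.primes ∧ (fc.row p).p = p := by
  unfold row
  cases hfind : fc.primes.find? (fun e => e.p == p) with
  | none =>
    exfalso
    rw [List.find?_eq_none] at hfind
    obtain ⟨e, he, hep⟩ := List.any_eq_true.mp h
    exact absurd hep (by simpa using hfind e he)
  | some e =>
    simp only [Option.getD_some]
    exact ⟨List.mem_of_find?_eq_some hfind, by simpa using List.find?_some hfind⟩

end ClFieldCertQ2

end Summit.BirchSwinnertonDyer.BirchSwinnertonDyer.Rank2Observatory.TwoDescCl
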